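import Summits.HodgeConjecture.HodgeConjecture.Theorems.Ring2AbelianAllSpreadExistential
import HarnessLib

/-!
# Ring 2 · §AbelianAll (seat `ab-spread-1`), VI — the COMMON FLOOR and the COMMON ROOF of the two branches:
# CM-spreading along SOME CM-pointed abelian family per class (FS_∃, below BOTH per-class bottoms CPS_∃ and U_∃,
# closing with `HC_CM` and NO named fact) and CM-spreading on ALL CM-pointed abelian families (FS_CM, above BOTH
# universal nodes CPS_CM and U, below `AbelianSchemeVHC`, on path with NO named fact)

HONEST FRAMING: research route, not a corollary; conditional on HC_CM plus one named minimal statement.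
(Cell line: research route conditional on HC_CM; not a corollary; Q11.4-sentence-2 already refuted in dim ≥ 3.)

Cell `pub-hodge-ring2`, sub-cell `pub-hodge-ring2-ab-*` (ALL ABELIAN VARIETIES), seat `ab-spread-1`, gen 3. `HC_CM` =
`Theses.RankFourFaces.CMAbelianHodge` (stmt-HodgeConjecture-3052) is a BINDER `hCM` wherever used, never a fact;
`HC_AV` = `Theses.PadicSemiregularLift.HodgeAbelianVarieties` (stmt-1333); the item `Theses.RankFourFaces.CMToAbelian`
(stmt-HodgeConjecture-16267) is OPEN and nothing here closes it. Nothing in this file is a case of the Hodge conjecture.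
No statement minted in this cell is cited as a fact: the two new nodes are `@[conjecture]` defs used ONLY as
hypotheses; the printed inputs enter as the literature seat's named facts `andre1996_cmAnchoredPencil` (`h₂₁`, André
1996 Lemme 6.3.1, a THEOREM in print) and `deligne1982_cmDenseMumfordTateFamilies` (`hF`, Deligne 1982 Prop. 6.1 =
Charles–Schnell Thm. 11.5.11, a THEOREM in print), and only on the ON-PATH side of FS_∃ / the CLOSING side of FS_CM.

## Why this part exists (REFEREE-AB F-ab-12: "pencil axis and Mumford–Tate axis incomparable in the tree"; LEAD
## L12.3 (iv): B_min is branch-relative — CPS_∃ (pencil), U_∃ (Mumford–Tate), both KIND 2, both exact)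

The sub-cell's two weakest proved-sufficient complements of `HC_CM` live on different carriers: deform XIII's CPS_∃
(`Ring2.Deform.CMAnchoredPencilCMSpreading`: a 6.3.1 compact pencil per class, relative dimension `2·dim A`, class
carried up to an isogeny factor `g : A ⟶ A₁`, `q ≠ 0`) and part IV's U_∃ (`CMDenseFamilyCMSpreading`: a CM-DENSE
Mumford–Tate family per class, relative dimension `dim A`, class carried on the nose). No implication between them is
known or claimed (F-ab-12; André 1996 p. 32: the 6.3.1 pencil base is a generic linear curve section of the Hodge-type
family missing the Baily–Borel boundary, hence NOT CM-dense — the two carrier classes meet only over compact Shimura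
curves). What the kernel CAN say is typed here, with every edge fact-free unless a bracket is displayed:

* the COMMON FLOOR **FS_∃** `CMAnchoredFamilyCMSpreading`: per class `(A, p, c)`, SOME smooth projective family of
  abelian varieties over a smooth irreducible quasi-projective base (row U's carriers VERBATIM) whose CM locus is
  NON-EMPTY (instead of dense), carrying `c` in the 6.3.1 form (`g^*(e₁^*(W|_{𝒳_s})) = q·c`, `q ≠ 0`), along which
  algebraicity spreads from the CM fibres to every fibre (`Ring2.Deform.CMSpreadingTo f n s₁` for all `s₁`, deform VII).
  KERNEL: `CPS_∃ ⟹ FS_∃`, `U_∃ ⟹ FS_∃` (§B), `HC_CM ∧ FS_∃ ⟹ HC_AV` with NO named fact (§C: `hCM` consumed once, at the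
  CM fibres, by deform II-b `forall_cmLocus_mem_algebraicClasses_of_HC_CM`), hence `FS_∃ ⟹ CMToAbelian`; on path
  `HC_AV ⟹ FS_∃` granted `h₂₁` OR granted `hF` (either branch's carrier); `ExactWithCM FS_∃` and `ModCM FS_∃ ↔ CMToAbelian`
  modulo `h₂₁ ∨ hF`. So the brief's `HC_AV_of_HC_CM_and_Bmin` holds with `B_min := FS_∃`, implied fact-free by EACH
  previous bottom — the weakest typed complement of `HC_CM` in the sub-cell so far, across branches.
* the COMMON ROOF **FS_CM** `CMPointedFamilyCMSpreading`: CM-spreading to every fibre on EVERY CM-pointed abelian family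
  (same carriers). KERNEL: `AbelianSchemeVHC ⟹ FS_CM ⟹ CPS_CM` and `FS_CM ⟹ U` (§B), on path `HC_AV ⟹ FS_CM` with NO fact,
  closing granted `h₂₁` (through CPS_CM, deform XIII row P) OR `hF` (through U, deform II-b row U); `FS_CM ⟹ FS_∃` mod
  `h₂₁ ∨ hF`.

Diamond (⟹ kernel; [·] bracket): `(1) ⟹ FS_CM ⟹ {CPS_CM, U}; CPS_CM ⟹[h₂₁] CPS_∃ ⟹ FS_∃; U ⟹[hF] U_∃ ⟹ FS_∃;
HC_CM ∧ FS_∃ ⟹ HC_AV`.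
HONEST COLUMN. (a) KIND (RING2-MAP rule "KIND by PREMISE"): both nodes have the premise "algebraic at EVERY CM fibre",
so both are KIND 2 (complementary: on path, closing, not known CM-idle under any print) — the target fibre of `HC_CM` is
itself a CM fibre, so neither node re-derives `HC_CM`; no `CMIdle` row exists or is claimed. (b) "Minimal" is NOT
claimed (F-ab-4): FS_∃ is below CPS_∃ and U_∃ only FORMALLY (no converse edge is known; under `HC_CM` all exact
complements coincide, §D). (c) The non-emptiness clause keeps FS_∃ honest: without it the constant family `A × pt`
would witness the node from `HC(A)` itself; with it a constant family witnesses FS_∃ at `(A, c)` only when `q·c` is a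
pull-back from a CM abelian variety (where `HC_CM` acts by pull-back alone); for `A` simple non-CM every witness is a
non-isotrivial deformation of an isogeny image of `A` to a CM fibre. (d) FS_CM is NOT small: over a NON-special curve
base the CM locus is finite (André–Oort), so after deleting all CM fibres but one (base still quasi-projective) FS_CM
contains one-CM-anchor transport along punctured curves; it is typed only as the roof under (1), never as `B_min`.
(e) No print locator states either node (nearest: Principle B — absolute Hodge, not algebraic; Charles–Schnell
Conj. 11.3.1 / Prop. 11.3.11; Abdulali (1.1)). (f) Not typer 2's `Ring2.Hypotheses.CMAnchoredFamilies` (EXISTENCE of a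
one-CM-fibre Mumford–Tate family per class, eigenvalue CM typing) — the nodes here assert SPREADING.

References (bib keys): Andre1996Motifs (Lemme 6.3.1 p. 31, proof p. 32, Remarque 2 p. 33); Deligne1982HodgeCycles
(Prop. 6.1, Thm. 2.12, Prop. 2.9); CharlesSchnell2014Notes (Thm. 11.5.11, Conj. 11.3.1, Prop. 11.3.11, Cor. 11.3.6);
Abdulali1994FamiliesAV ((1.1), Lemma 6.2); Tsimerman2018AndreOort (Thm. 1.1).
-/

set_option linter.dupNamespace false

noncomputable section

namespace Summit.HodgeConjecture.HodgeConjecture.Ring2.AbelianAll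

open CategoryTheory AlgebraicGeometry
open Literature.AlgebraicGeometry Literature.AlgebraicGeometry.Motives
open Literature.AlgebraicGeometry.HodgeTheory
open Literature.AlgebraicGeometry.Milne1999 (IsOfCMType)
open Literature.AlgebraicGeometry.Andre1996 (andre1996_cmAnchoredPencil IsCMAnchoredPencilFor
  compactPencil_irreducibleSpace_base compactPencil_smooth_base compactPencil_exists_abelianVariety_fiber_dim)
open Literature.AlgebraicGeometry.Deligne1982 (deligne1982_cmDenseMumfordTateFamilies IsCMDenseMumfordTateFamilyFor)
open Summit.HodgeConjecture.HodgeConjecture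
open Summit.HodgeConjecture.HodgeConjecture.Theses
open Summit.HodgeConjecture.HodgeConjecture.Theses.RankFourFaces (CMAbelianHodge CMToAbelian)
open Summit.HodgeConjecture.HodgeConjecture.Theses.PadicSemiregularLift (HodgeAbelianVarieties)
open Summit.HodgeConjecture.HodgeConjecture.Ring2.Deform (cmLocus UniformAlgebraicityAtCMPoints CMSpreadingTo
  CMSpreadingAt CMPointedPencilCMSpreading CMAnchoredPencilCMSpreading forall_cmLocus_mem_algebraicClasses_of_HC_CM
  uniformAlgebraicityAtCMPoints_of_forall_cmSpreadingAt cmAnchoredPencilCMSpreading_of_andre1996_of_cmPointedPencilCMSpreading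
  cmAnchoredPencilCMSpreading_of_andre1996_of_HC_AV HC_AV_of_hodgeConjecture)
open Summit.HodgeConjecture.HodgeConjecture.Ring2.Hypotheses (AbelianSchemeVHC abelianSchemeVHC_of_hc_av
  abelianSchemeVHC_of_hodgeConjecture)
open Summit.HodgeConjecture.HodgeConjecture.Theorems.HodgeAbelianVarieties.Negative (iff_hodgeConjecture_restricted)

variable {𝒳 S : SchemeOver ℂ}

/-! ## §A The carriers and the two nodes -/

/-- **A CM-POINTED ABELIAN FAMILY of relative dimension `n`** (a predicate on `f : 𝒳 ⟶ S`; nothing is asserted):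
the binders of row U (`Ring2.Deform.UniformAlgebraicityAtCMPoints` = Charles–Schnell Thm. 11.5.11's family shape)
VERBATIM — `f` smooth projective of relative dimension `n`, `𝒳` and `S` quasi-projective, `S` irreducible and smooth
over `ℂ`, every fibre charted by an abelian variety of dimension `n` — with DENSITY of the CM locus replaced by
NON-EMPTINESS: some fibre is charted by an `n`-dimensional abelian variety of CM type (`cmLocus f n`, deform II-b;
the CM typing is `Milne1999.IsOfCMType`, the binder of `HC_CM`). Compact pencils with a CM fibre and CM-dense
Mumford–Tate families are both instances (§A below). [cite: CharlesSchnell2014Notes, Thm. 11.5.11 (a)–(c) (p. 516)]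
[cite: Deligne1982HodgeCycles, Prop. 6.1 (p. 71)] [cite: Andre1996Motifs, §6.3 footnote (2) (p. 31)] -/
def IsCMPointedAbelianFamily (f : 𝒳 ⟶ S) (n : ℕ) : Prop :=
  IsSmoothProjectiveFamily f n ∧ IsQuasiProjectiveOver 𝒳 ∧ IsQuasiProjectiveOver S ∧ IrreducibleSpace S.left ∧
    AlgebraicGeometry.Smooth S.hom ∧
    (∀ s : ComplexPoints S, ∃ A' : AbelianVariety ℂ, A'.dim = n ∧ Nonempty (A'.X ≅ fiberOver f s)) ∧
    (cmLocus f n).Nonempty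

/-- **A CM-pointed abelian family ANCHORED FOR `(A, p, c)`** (predicate): a CM-pointed abelian family of relative
dimension `n` carrying the class `c ∈ H^{2p}(A(ℂ); ℂ)` in the form of André's Lemme 6.3.1 (i)+(iii)
(`Andre1996.IsCMAnchoredPencilFor`, data part verbatim): a point `s`, a global class `W ∈ H^{2p}(𝒳(ℂ); ℂ)` with
fibrewise rational `(p,p)` restrictions, an abelian variety `A₁` with `e₁ : A₁.X ≅ 𝒳_s` and a homomorphism
`g : A ⟶ A₁` with `g^*(e₁^*(W|_{𝒳_s})) = q·c`, `q ∈ ℚ`, `q ≠ 0`. The Mumford–Tate shape (Deligne Prop. 6.1 (a)(b):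
`n = dim A`, `A₁ = A`, `g = 𝟙`, `q = 1`) and the pencil shape (`n = 2·dim A`, `A₁ ∼ A × A`) are both instances.
[cite: Andre1996Motifs, Lemme 6.3.1 (p. 31)] [cite: Deligne1982HodgeCycles, Prop. 6.1 (a)(b) (p. 71)] -/
def IsCMAnchoredFamilyFor (A : AbelianVariety ℂ) (p : ℕ) (c : complexBetti A.X (2 * p)) (f : 𝒳 ⟶ S) (n : ℕ) :
    Prop :=
  IsCMPointedAbelianFamily f n ∧
    ∃ (s : ComplexPoints S) (W : complexBetti 𝒳 (2 * p)) (A₁ : AbelianVariety ℂ) (e₁ : A₁.X ≅ fiberOver f s)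
      (g : A ⟶ A₁) (q : ℚ),
      (∀ s' : ComplexPoints S, IsRationalClass (complexBetti.map (fiberι f s') (2 * p) W) ∧
        IsOfHodgeType n (fiberOver f s') (2 * p) p p (complexBetti.map (fiberι f s') (2 * p) W)) ∧
      q ≠ 0 ∧
      complexBetti.map g.hom.hom.hom (2 * p)
          (complexBetti.map e₁.hom (2 * p) (complexBetti.map (fiberι f s) (2 * p) W)) = (q : ℂ) • c

/-- **CM-SPREADING ON ALL CM-POINTED ABELIAN FAMILIES** (FS_CM, the common ROOF). For every CM-pointed abelian family
`f : 𝒳 ⟶ S` of relative dimension `n` (`IsCMPointedAbelianFamily f n`) and every `s₁ ∈ S(ℂ)`: a global class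
`W ∈ H^{2p}(𝒳(ℂ); ℂ)`, fibrewise rational of type `(p,p)`, algebraic at EVERY CM fibre, is algebraic at `s₁`
(`Ring2.Deform.CMSpreadingTo f n s₁`). Row U with "CM-dense" weakened to "CM-pointed"; deform XIII's CPS_CM with
"compact pencil" weakened to "abelian family over any smooth irreducible quasi-projective base". Implied by
`AbelianSchemeVHC` (one anchor suffices there), implies CPS_CM and U (§B); on path with NO fact. OPEN; no print
locator of its own; NOT small (module docstring (d)); a HYPOTHESIS wherever used; never asserted.
[cite: CharlesSchnell2014Notes, Conj. 11.3.1 and Prop. 11.3.11] [cite: Abdulali1994FamiliesAV, (1.1) (p. 1122)]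
[cite: Deligne1982HodgeCycles, Thm. 2.12 and Prop. 2.9] [status: open] -/
@[conjecture] def CMPointedFamilyCMSpreading : Prop :=
  ∀ ⦃n : ℕ⦄ ⦃𝒳 S : SchemeOver ℂ⦄ (f : 𝒳 ⟶ S), IsCMPointedAbelianFamily f n →
    ∀ s₁ : ComplexPoints S, CMSpreadingTo f n s₁

/-- **CM-SPREADING ALONG SOME CM-POINTED ABELIAN FAMILY, PER HODGE CLASS** (FS_∃, the common FLOOR). For every complex
abelian variety `A` (smooth projective of dimension `dim A`), every `p` and every rational `(p,p)` class `c` on `A`,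
there are `n` and a CM-pointed abelian family `f : 𝒳 ⟶ S` anchored for `(A, p, c)` (`IsCMAnchoredFamilyFor A p c f n`)
along which algebraicity spreads from the CM fibres to every fibre (`Ring2.Deform.CMSpreadingTo f n s₁` for all `s₁`).
Implied fact-free by deform XIII's CPS_∃ (`CMAnchoredPencilCMSpreading`) AND by part IV's U_∃
(`CMDenseFamilyCMSpreading`) (§B); with `HC_CM` it gives `HC_AV` with NO named fact (§C); on path granted Lemme 6.3.1
OR Deligne's family fact. OPEN; no print locator of its own (Principle B transports absolute-Hodge-ness, not
algebraicity); a HYPOTHESIS wherever used; never asserted; "minimal" not claimed (F-ab-4).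
[cite: Andre1996Motifs, Lemme 6.3.1 (p. 31) and §6.3 a) (p. 33)] [cite: CharlesSchnell2014Notes, Thm. 11.5.11 and
Conj. 11.3.1] [cite: Deligne1982HodgeCycles, Prop. 6.1, Thm. 2.12 and Prop. 2.9] [status: open] -/
@[conjecture] def CMAnchoredFamilyCMSpreading : Prop :=
  ∀ (A : AbelianVariety ℂ), IsSmoothProjective A.dim A.X →
    ∀ (p : ℕ) (c : complexBetti A.X (2 * p)), IsRationalClass c → IsOfHodgeType A.dim A.X (2 * p) p p c →
      ∃ (n : ℕ) (𝒳 S : SchemeOver ℂ) (f : 𝒳 ⟶ S), IsCMAnchoredFamilyFor A p c f n ∧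
        ∀ s₁ : ComplexPoints S, CMSpreadingTo f n s₁

/-! ### The two printed carriers are CM-pointed abelian families -/

/-- A compact pencil of abelian varieties (André's «pinceau compact») with a CM fibre is a CM-pointed abelian family:
projective ⟹ quasi-projective (`j = 𝟙`), the base curve is irreducible and smooth, the charts have dimension `d`.
[cite: Andre1996Motifs, §6.3 footnote (2) (p. 31)] -/
theorem isCMPointedAbelianFamily_of_compactPencil {f : 𝒳 ⟶ S} {d : ℕ} (hf : IsCompactAbelianPencil f d)
    (hne : (cmLocus f d).Nonempty) : IsCMPointedAbelianFamily f d :=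
  ⟨hf.isSmoothProjectiveFamily, IsQuasiProjectiveOver.of_isProjectiveOver hf.isSmoothProjective_total.isProjectiveOver,
    IsQuasiProjectiveOver.of_isProjectiveOver hf.isSmoothProjective_base.isProjectiveOver,
    compactPencil_irreducibleSpace_base hf, compactPencil_smooth_base hf, compactPencil_exists_abelianVariety_fiber_dim hf,
    hne⟩

/-- A 6.3.1 pencil CM-anchored for `(A, p, c)` is a CM-pointed abelian family anchored for `(A, p, c)` at relative
dimension `2·dim A` (its CM fibre `𝒳_t ≅ A₀.X` lies in the CM locus: `mem_cmLocus_of_compactPencil`).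
[cite: Andre1996Motifs, Lemme 6.3.1 (i)–(iii) (p. 31)] -/
theorem isCMAnchoredFamilyFor_of_isCMAnchoredPencilFor {A : AbelianVariety ℂ} {p : ℕ} {c : complexBetti A.X (2 * p)}
    {f : 𝒳 ⟶ S} (h : IsCMAnchoredPencilFor A p c f) : IsCMAnchoredFamilyFor A p c f (2 * A.dim) := by
  obtain ⟨hf, s, t, W, A₁, A₀, e₁, g, q, hW, hq, hgc, ⟨e₀⟩, hA₀⟩ := h
  exact ⟨isCMPointedAbelianFamily_of_compactPencil hf ⟨t, mem_cmLocus_of_compactPencil hf e₀ hA₀⟩,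
    s, W, A₁, e₁, g, q, hW, hq, hgc⟩

/-- A CM-dense Mumford–Tate family for `(A, p, c)` (Charles–Schnell Thm. 11.5.11 (a)–(c)) is a CM-pointed abelian family
anchored for `(A, p, c)` at relative dimension `dim A` (`A₁ = A`, `g = 𝟙`, `q = 1`; dense ⟹ non-empty since `s₁ ∈ S(ℂ)`).
[cite: CharlesSchnell2014Notes, Thm. 11.5.11 (p. 516)] [cite: Deligne1982HodgeCycles, Prop. 6.1 (p. 71)] -/
theorem isCMAnchoredFamilyFor_of_isCMDenseMumfordTateFamilyFor {A : AbelianVariety ℂ} {p : ℕ}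
    {c : complexBetti A.X (2 * p)} {f : 𝒳 ⟶ S} (h : IsCMDenseMumfordTateFamilyFor A p c f) :
    IsCMAnchoredFamilyFor A p c f A.dim := by
  have hne : (cmLocus f A.dim).Nonempty := h.cmLocus_nonempty
  obtain ⟨s₁, e, W, hf, h𝒳, hS, hirr, hsm, hab, hW, hWc, _⟩ := h
  refine ⟨⟨hf, h𝒳, hS, hirr, hsm, hab, hne⟩, s₁, W, A, e, 𝟙 A, 1, hW, one_ne_zero, ?_⟩
  rw [hWc, Rat.cast_one, one_smul]
  exact abelianVariety_map_id_apply c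

/-! ## §B The diamond: fact-free edges -/

/-- **CPS_∃ ⟹ FS_∃** (pencil branch into the floor), NO fact. [cite: Andre1996Motifs, Lemme 6.3.1 (p. 31)] -/
theorem cmAnchoredFamilyCMSpreading_of_cmAnchoredPencilCMSpreading (h : CMAnchoredPencilCMSpreading) :
    CMAnchoredFamilyCMSpreading := by
  intro A hA p c hc hpp
  obtain ⟨𝒳, S, f, hanch, hS⟩ := h A hA p c hc hpp
  exact ⟨2 * A.dim, 𝒳, S, f, isCMAnchoredFamilyFor_of_isCMAnchoredPencilFor hanch, hS⟩

/-- **U_∃ ⟹ FS_∃** (Mumford–Tate branch into the floor), NO fact. [cite: CharlesSchnell2014Notes, Thm. 11.5.11] -/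
theorem cmAnchoredFamilyCMSpreading_of_cmDenseFamilyCMSpreading (h : CMDenseFamilyCMSpreading) :
    CMAnchoredFamilyCMSpreading := by
  intro A hA p c hc hpp
  obtain ⟨𝒳, S, f, hfam, hS⟩ := h A hA p c hc hpp
  exact ⟨A.dim, 𝒳, S, f, isCMAnchoredFamilyFor_of_isCMDenseMumfordTateFamilyFor hfam, hS⟩

/-- **FS_CM ⟹ CPS_CM** (roof onto the pencil branch), NO fact. [cite: Andre1996Motifs, §6.3 footnote (2) (p. 31)] -/
theorem cmPointedPencilCMSpreading_of_cmPointedFamilyCMSpreading (h : CMPointedFamilyCMSpreading) :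
    CMPointedPencilCMSpreading :=
  fun _ _ _ f hf hne s₁ ↦ h f (isCMPointedAbelianFamily_of_compactPencil hf hne) s₁

/-- **FS_CM ⟹ U** (roof onto the Mumford–Tate branch), NO fact: over a CM-dense base with a point `s₁` the CM locus is
non-empty; then deform VII's "row U is local in the variety". [cite: CharlesSchnell2014Notes, Prop. 11.3.11] -/
theorem uniformAlgebraicityAtCMPoints_of_cmPointedFamilyCMSpreading (h : CMPointedFamilyCMSpreading) :
    UniformAlgebraicityAtCMPoints := by
  refine uniformAlgebraicityAtCMPoints_of_forall_cmSpreadingAt fun A ↦ ?_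
  intro 𝒳 S f s₁ _ hf h𝒳 hS hirr hsm hab hD
  haveI : Nonempty (ComplexPoints S) := ⟨s₁⟩
  exact h f ⟨hf, h𝒳, hS, hirr, hsm, hab, hD.nonempty⟩ s₁

/-- **`AbelianSchemeVHC ⟹ FS_CM`** (the roof sits under (1)), NO fact: feed (1)'s "algebraic at some fibre" with a CM
fibre. [cite: CharlesSchnell2014Notes, Conj. 11.3.1] [cite: Abdulali1994FamiliesAV, (1.1) (p. 1122)] -/
theorem cmPointedFamilyCMSpreading_of_abelianSchemeVHC (hV : AbelianSchemeVHC) : CMPointedFamilyCMSpreading := by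
  intro n 𝒳 S f hfam s₁ p W hW hcm
  obtain ⟨hf, _, _, hirr, hsm, hab, s₀, hs₀⟩ := hfam
  exact hV f hf hirr hsm hab p W hW ⟨s₀, hcm s₀ hs₀⟩ s₁

/-- **FS_CM ⟹ FS_∃ granted Lemme 6.3.1** (through CPS_CM ⟹[h₂₁] CPS_∃). [cite: Andre1996Motifs, Lemme 6.3.1 (p. 31)] -/
theorem cmAnchoredFamilyCMSpreading_of_andre1996_of_cmPointedFamilyCMSpreading (h₂₁ : andre1996_cmAnchoredPencil)
    (h : CMPointedFamilyCMSpreading) : CMAnchoredFamilyCMSpreading :=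
  cmAnchoredFamilyCMSpreading_of_cmAnchoredPencilCMSpreading
    (cmAnchoredPencilCMSpreading_of_andre1996_of_cmPointedPencilCMSpreading h₂₁
      (cmPointedPencilCMSpreading_of_cmPointedFamilyCMSpreading h))

/-- **FS_CM ⟹ FS_∃ granted Deligne's family fact** (through U ⟹[hF] U_∃). [cite: Deligne1982HodgeCycles, Prop. 6.1] -/
theorem cmAnchoredFamilyCMSpreading_of_deligne1982_of_cmPointedFamilyCMSpreading
    (hF : deligne1982_cmDenseMumfordTateFamilies) (h : CMPointedFamilyCMSpreading) : CMAnchoredFamilyCMSpreading :=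
  cmAnchoredFamilyCMSpreading_of_cmDenseFamilyCMSpreading
    (cmDenseFamilyCMSpreading_of_deligne1982_of_uniform hF (uniformAlgebraicityAtCMPoints_of_cmPointedFamilyCMSpreading h))

/-- **The diamond in one statement, all fact-free**: `(1) ⟹ FS_CM ⟹ {CPS_CM, U}` and `{CPS_∃, U_∃} ⟹ FS_∃`.
[cite: CharlesSchnell2014Notes, Conj. 11.3.1, Prop. 11.3.11 and Thm. 11.5.11] [cite: Andre1996Motifs, Lemme 6.3.1] -/
theorem commonRoof_commonFloor :
    (AbelianSchemeVHC → CMPointedFamilyCMSpreading) ∧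
      (CMPointedFamilyCMSpreading → CMPointedPencilCMSpreading) ∧
      (CMPointedFamilyCMSpreading → UniformAlgebraicityAtCMPoints) ∧
      (CMAnchoredPencilCMSpreading → CMAnchoredFamilyCMSpreading) ∧
      (CMDenseFamilyCMSpreading → CMAnchoredFamilyCMSpreading) :=
  ⟨cmPointedFamilyCMSpreading_of_abelianSchemeVHC, cmPointedPencilCMSpreading_of_cmPointedFamilyCMSpreading,
    uniformAlgebraicityAtCMPoints_of_cmPointedFamilyCMSpreading,
    cmAnchoredFamilyCMSpreading_of_cmAnchoredPencilCMSpreading, cmAnchoredFamilyCMSpreading_of_cmDenseFamilyCMSpreading⟩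

/-! ## §C The rows of the floor: `HC_CM` load-bearing, NO named fact -/

/-- **`HC_CM ∧ FS_∃ ⟹` Hodge for every complex abelian variety — NO named fact** (variety by variety). Given a rational
`(p,p)` class `c` on `A`, take the FS_∃ family; `HC_CM` makes its global class `W` algebraic at EVERY CM fibre
(`Ring2.Deform.forall_cmLocus_mem_algebraicClasses_of_HC_CM` — the only use of `hCM`); CM-spreading concludes at the
fibre `𝒳_s`; across `e₁ : A₁.X ≅ 𝒳_s`, back along `g : A ⟶ A₁` (pull-backs of algebraic classes along homomorphisms of
abelian varieties are algebraic, `map_mem_algebraicClasses_of_abelianVariety`), divide by `q ≠ 0` — the last lines of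
deform XIII `hodgeConjecture_abelian_of_HC_CM_of_cmAnchoredPencilCMSpreading`, now on the common carrier.
[cite: Andre1996Motifs, §6.3 a) (p. 33)] [cite: Abdulali1994FamiliesAV, Lemma 6.2 (p. 1131)]
[cite: Deligne1982HodgeCycles, §6 proof of Thm. 2.11 (pp. 71–73)] -/
theorem hodgeConjecture_abelian_of_HC_CM_of_cmAnchoredFamilyCMSpreading (hCM : CMAbelianHodge)
    (h : CMAnchoredFamilyCMSpreading) :
    ∀ A : AbelianVariety ℂ, IsSmoothProjective A.dim A.X → HodgeConjectureFor A.dim A.X := by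
  intro A hA
  refine (hodgeConjectureFor_iff_of_isSmoothProjective nonempty_hodgeModel_holds hA).2 ?_
  intro p c hc hpp
  obtain ⟨n, 𝒳, S, f, ⟨_, s, W, A₁, e₁, g, q, hW, hq, hgc⟩, hS⟩ := h A hA p c hc hpp
  -- `HC_CM` at every CM fibre, then CM-spreading to the fibre `s`
  have h₁ : complexBetti.map (fiberι f s) (2 * p) W ∈ algebraicClasses (fiberOver f s) p :=
    hS s p W hW (forall_cmLocus_mem_algebraicClasses_of_HC_CM hCM f W hW)
  -- across `e₁` and back along `g`
  have h₂ : complexBetti.map e₁.hom (2 * p) (complexBetti.map (fiberι f s) (2 * p) W) ∈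
      algebraicClasses A₁.X p :=
    (mem_algebraicClasses_map_iff_of_iso e₁).2 h₁
  have h₃ : (q : ℂ) • c ∈ algebraicClasses A.X p := by
    rw [← hgc]
    exact map_mem_algebraicClasses_of_abelianVariety hA A₁ g.hom.hom.hom h₂
  exact (Submodule.smul_mem_iff _ (Rat.cast_ne_zero.2 hq)).1 h₃

/-- **`HC_AV_of_HC_CM_and_cmAnchoredFamilyCMSpreading` — the brief's `HC_AV_of_HC_CM_and_Bmin` with `B_min := FS_∃`, the
common floor of both branches, and EXACTLY two hypotheses**: `HC_CM → FS_∃ → HC_AV`. [cite: Andre1996Motifs, §6.3 a)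
(p. 33)] [cite: CharlesSchnell2014Notes, Thm. 11.5.11] -/
theorem HC_AV_of_HC_CM_and_cmAnchoredFamilyCMSpreading (hCM : CMAbelianHodge) (h : CMAnchoredFamilyCMSpreading) :
    HodgeAbelianVarieties :=
  iff_hodgeConjecture_restricted.2 (hodgeConjecture_abelian_of_HC_CM_of_cmAnchoredFamilyCMSpreading hCM h)

/-- FS_∃ closes with `HC_CM`, NO fact (LEAD grammar). [folklore] -/
theorem closesWithCM_cmAnchoredFamilyCMSpreading : ClosesWithCM CMAnchoredFamilyCMSpreading :=
  fun hCM h ↦ HC_AV_of_HC_CM_and_cmAnchoredFamilyCMSpreading hCM h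

/-- Hence `FS_∃ ⟹ CMToAbelian` outright (a typed conditional TOWARD stmt-HodgeConjecture-16267, which stays OPEN).
[folklore] -/
theorem cmToAbelian_of_cmAnchoredFamilyCMSpreading (h : CMAnchoredFamilyCMSpreading) : CMToAbelian :=
  cmToAbelian_of_closesWithCM closesWithCM_cmAnchoredFamilyCMSpreading h

/-- ON-PATH granted Lemme 6.3.1: `HC_AV ⟹ FS_∃` (through CPS_∃). [cite: Andre1996Motifs, Lemme 6.3.1 (p. 31)]
[cite: CharlesSchnell2014Notes, Cor. 11.3.6] -/
theorem cmAnchoredFamilyCMSpreading_of_andre1996_of_HC_AV (h₂₁ : andre1996_cmAnchoredPencil)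
    (h : HodgeAbelianVarieties) : CMAnchoredFamilyCMSpreading :=
  cmAnchoredFamilyCMSpreading_of_cmAnchoredPencilCMSpreading (cmAnchoredPencilCMSpreading_of_andre1996_of_HC_AV h₂₁ h)

/-- ON-PATH granted Deligne's family fact: `HC_AV ⟹ FS_∃` (through U_∃). [cite: Deligne1982HodgeCycles, Prop. 6.1]
[cite: CharlesSchnell2014Notes, Cor. 11.3.6 and Thm. 11.5.11] -/
theorem cmAnchoredFamilyCMSpreading_of_deligne1982_of_HC_AV (hF : deligne1982_cmDenseMumfordTateFamilies)
    (h : HodgeAbelianVarieties) : CMAnchoredFamilyCMSpreading :=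
  cmAnchoredFamilyCMSpreading_of_cmDenseFamilyCMSpreading (cmDenseFamilyCMSpreading_of_deligne1982_of_HC_AV hF h)

/-- `OnPathAV FS_∃` modulo EITHER printed carrier fact (the first complement of the sub-cell whose on-path bracket is a
disjunction). [cite: Andre1996Motifs, Lemme 6.3.1] [cite: Deligne1982HodgeCycles, Prop. 6.1] -/
theorem onPathAV_cmAnchoredFamilyCMSpreading_of_or
    (h : andre1996_cmAnchoredPencil ∨ deligne1982_cmDenseMumfordTateFamilies) : OnPathAV CMAnchoredFamilyCMSpreading :=
  fun hAV ↦ h.elim (fun h₂₁ ↦ cmAnchoredFamilyCMSpreading_of_andre1996_of_HC_AV h₂₁ hAV)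
    (fun hF ↦ cmAnchoredFamilyCMSpreading_of_deligne1982_of_HC_AV hF hAV)

/-- **EXACTNESS: `HC_AV ↔ HC_CM ∧ FS_∃`, modulo `h₂₁ ∨ hF`** — both factors genuine in the kernel; in print `HC_CM` is NOT
known to follow from FS_∃ (KIND 2); the fact sits on the on-path side only. [cite: CharlesSchnell2014Notes, Cor. 11.3.6]
[cite: Andre1996Motifs, Lemme 6.3.1 and Remarque 2 (pp. 31–33)] -/
theorem exactWithCM_cmAnchoredFamilyCMSpreading_of_or
    (h : andre1996_cmAnchoredPencil ∨ deligne1982_cmDenseMumfordTateFamilies) : ExactWithCM CMAnchoredFamilyCMSpreading :=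
  exactWithCM_iff.2 ⟨closesWithCM_cmAnchoredFamilyCMSpreading, onPathAV_cmAnchoredFamilyCMSpreading_of_or h⟩

/-- Relativised to `HC_CM`, the floor IS the item: `ModCM FS_∃ ↔ CMToAbelian`, mod `h₂₁ ∨ hF`. [folklore] -/
theorem modCM_cmAnchoredFamilyCMSpreading_iff_cmToAbelian_of_or
    (h : andre1996_cmAnchoredPencil ∨ deligne1982_cmDenseMumfordTateFamilies) :
    ModCM CMAnchoredFamilyCMSpreading ↔ CMToAbelian :=
  modCM_iff_cmToAbelian_of_exactWithCM (exactWithCM_cmAnchoredFamilyCMSpreading_of_or h)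

/-- Class axis: under `HC_CM`, FS_∃ closes EVERY class target `HCOnClass 𝒞` of typer 1's atlas axis, fact-free.
[folklore] -/
theorem hcOnClass_of_HC_CM_of_cmAnchoredFamilyCMSpreading (hCM : CMAbelianHodge) (h : CMAnchoredFamilyCMSpreading)
    (𝒞 : AbelianVariety ℂ → Prop) : ClassTargets.HCOnClass 𝒞 :=
  hcOnClass_of_closesWithCM closesWithCM_cmAnchoredFamilyCMSpreading hCM h 𝒞

/-! ## §D The rows of the roof, and the collapse modulo `HC_CM` -/

/-- ON-PATH with NO fact: `HC_AV ⟹ FS_CM` (through `AbelianSchemeVHC`, deform's `abelianSchemeVHC_of_HC_AV`).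
[cite: CharlesSchnell2014Notes, Cor. 11.3.6] -/
theorem onPathAV_cmPointedFamilyCMSpreading : OnPathAV CMPointedFamilyCMSpreading :=
  fun h ↦ cmPointedFamilyCMSpreading_of_abelianSchemeVHC (abelianSchemeVHC_of_hc_av h)

/-- ON-PATH from the summit, NO fact. [folklore] -/
theorem cmPointedFamilyCMSpreading_of_hodgeConjecture (hHC : _root_.HodgeConjecture) : CMPointedFamilyCMSpreading :=
  cmPointedFamilyCMSpreading_of_abelianSchemeVHC (abelianSchemeVHC_of_hodgeConjecture hHC)

/-- The roof closes with `HC_CM` modulo EITHER fact (through the floor). [cite: Andre1996Motifs, Lemme 6.3.1]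
[cite: Deligne1982HodgeCycles, Prop. 6.1] -/
theorem closesWithCM_cmPointedFamilyCMSpreading_of_or
    (h : andre1996_cmAnchoredPencil ∨ deligne1982_cmDenseMumfordTateFamilies) : ClosesWithCM CMPointedFamilyCMSpreading :=
  fun hCM hS ↦ HC_AV_of_HC_CM_and_cmAnchoredFamilyCMSpreading hCM
    (h.elim (fun h₂₁ ↦ cmAnchoredFamilyCMSpreading_of_andre1996_of_cmPointedFamilyCMSpreading h₂₁ hS)
      (fun hF ↦ cmAnchoredFamilyCMSpreading_of_deligne1982_of_cmPointedFamilyCMSpreading hF hS))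

/-- **EXACTNESS of the roof: `HC_AV ↔ HC_CM ∧ FS_CM`, modulo `h₂₁ ∨ hF`** (here the fact sits on the CLOSING side).
[cite: CharlesSchnell2014Notes, Conj. 11.3.1 and Cor. 11.3.6] -/
theorem exactWithCM_cmPointedFamilyCMSpreading_of_or
    (h : andre1996_cmAnchoredPencil ∨ deligne1982_cmDenseMumfordTateFamilies) : ExactWithCM CMPointedFamilyCMSpreading :=
  exactWithCM_iff.2 ⟨closesWithCM_cmPointedFamilyCMSpreading_of_or h, onPathAV_cmPointedFamilyCMSpreading⟩

/-- **Collapse modulo `HC_CM`**: granted `h₂₁ ∨ hF` and `HC_CM`, roof, floor and target are ONE statement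
(`FS_CM ↔ HC_AV`, `FS_∃ ↔ HC_AV`, `FS_CM ↔ FS_∃`). WITHOUT `HC_CM` only the displayed one-way edges are known.
[cite: Andre1996Motifs, Remarque 2 (p. 33)] [cite: CharlesSchnell2014Notes, Cor. 11.3.6] -/
theorem commonRoof_commonFloor_collapse_of_HC_CM
    (h : andre1996_cmAnchoredPencil ∨ deligne1982_cmDenseMumfordTateFamilies) (hCM : CMAbelianHodge) :
    (CMPointedFamilyCMSpreading ↔ HodgeAbelianVarieties) ∧ (CMAnchoredFamilyCMSpreading ↔ HodgeAbelianVarieties) ∧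
      (CMPointedFamilyCMSpreading ↔ CMAnchoredFamilyCMSpreading) :=
  ⟨iff_HC_AV_of_exactWithCM_of_HC_CM (exactWithCM_cmPointedFamilyCMSpreading_of_or h) hCM,
    iff_HC_AV_of_exactWithCM_of_HC_CM (exactWithCM_cmAnchoredFamilyCMSpreading_of_or h) hCM,
    iff_of_exactWithCM_of_HC_CM (exactWithCM_cmPointedFamilyCMSpreading_of_or h)
      (exactWithCM_cmAnchoredFamilyCMSpreading_of_or h) hCM⟩

/-- Under `HC_CM` the floor is each branch's bottom: `FS_∃ ↔ CPS_∃` granted `h₂₁`, `FS_∃ ↔ U_∃` granted `hF`.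
[cite: Andre1996Motifs, Lemme 6.3.1] [cite: Deligne1982HodgeCycles, Prop. 6.1] -/
theorem commonFloor_iff_bottoms_of_HC_CM (hCM : CMAbelianHodge) :
    (andre1996_cmAnchoredPencil → (CMAnchoredFamilyCMSpreading ↔ CMAnchoredPencilCMSpreading)) ∧
      (deligne1982_cmDenseMumfordTateFamilies → (CMAnchoredFamilyCMSpreading ↔ CMDenseFamilyCMSpreading)) :=
  ⟨fun h₂₁ ↦ iff_of_exactWithCM_of_HC_CM (exactWithCM_cmAnchoredFamilyCMSpreading_of_or (Or.inl h₂₁))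
      (exactWithCM_cmSpreading_of_andre1996 h₂₁).1 hCM,
    fun hF ↦ iff_of_exactWithCM_of_HC_CM (exactWithCM_cmAnchoredFamilyCMSpreading_of_or (Or.inr hF))
      (exactWithCM_cmDenseFamilyCMSpreading hF) hCM⟩

/-- Relativised, no `HC_CM` hypothesis: `ModCM FS_∃ ↔ ModCM CPS_∃` [h₂₁], `↔ ModCM U_∃` [hF] (all the item). [folklore] -/
theorem modCM_commonFloor_iff_modCM_bottoms :
    (andre1996_cmAnchoredPencil → (ModCM CMAnchoredFamilyCMSpreading ↔ ModCM CMAnchoredPencilCMSpreading)) ∧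
      (deligne1982_cmDenseMumfordTateFamilies → (ModCM CMAnchoredFamilyCMSpreading ↔ ModCM CMDenseFamilyCMSpreading)) :=
  ⟨fun h₂₁ ↦ (modCM_cmAnchoredFamilyCMSpreading_iff_cmToAbelian_of_or (Or.inl h₂₁)).trans
      (modCM_cmAnchoredPencilCMSpreading_iff_cmToAbelian h₂₁).symm,
    fun hF ↦ (modCM_cmAnchoredFamilyCMSpreading_iff_cmToAbelian_of_or (Or.inr hF)).trans
      (modCM_cmDenseFamilyCMSpreading_iff_cmToAbelian hF).symm⟩

#print axioms Summit.HodgeConjecture.HodgeConjecture.Ring2.AbelianAll.HC_AV_of_HC_CM_and_cmAnchoredFamilyCMSpreading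
#print axioms Summit.HodgeConjecture.HodgeConjecture.Ring2.AbelianAll.exactWithCM_cmAnchoredFamilyCMSpreading_of_or

end Summit.HodgeConjecture.HodgeConjecture.Ring2.AbelianAll

end
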